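import Literature.MathematicalPhysics.QuantumFieldTheory.Balaban1983to89.Node00.BackgroundCurrentShape
import Literature.MathematicalPhysics.QuantumFieldTheory.Balaban1983to89.B11Eq27Current
import Literature.MathematicalPhysics.QuantumFieldTheory.Balaban1983to89.B12Eq311Models
import Literature.MathematicalPhysics.QuantumFieldTheory.Balaban1983to89.B12Eq115BackgroundPair

/-!
# `Node00.BackgroundCurrentCompare` — the two printed CURRENT clauses COMPARED IN KERNEL: [Balaban1987RG1] (1.2)∕(1.8)
# `J = D^{η*}_U η⁻² π Im ∂U` IS `η⁻² π Im (D^{η*}_U ∂U)` of [Balaban1985Variational] (2) ∕ [Balaban1985RegularSpaces] (1.2), hence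
# `𝔘_k({T}, ε₀) ⊆ U_k(2ε₀)` and GAPS G₈a-3's (1.2)-form follows from its [B11] Thm 1 (8)-form with the constant `2`

statement-level skeleton of published theorems with citation tags; proofs where landed; nothing here is a claim about the Yang–Mills mass gap

HONEST FRAMING.  Bookkeeping over tree objects BY NAME (typing hand of `pub-ymgap-node00-def-B`, product 2; append-only NEW module under
`Node00.BackgroundCurrentShape`): the dictionary between the lineage's TWO typed covariant divergences on the torus — `B9Eq39Adjoint.divPη` of
[15] (3.9) (behind the (1.8) current `B12Eq18Current.current`) and `B10Eq68TorusRegularity.covDivT` of [Balaban1985RegularSpaces] (1.2) (behind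
[B11] (2)'s `RegDivAt`) — and its consequence for the two currencies of `Node00.BackgroundCurrentShape`.  Print treats the two spaces as one up to
`O(1)` in `ε₀` ([I] p. 260 «is implied by the condition on V, with 2ε₀ replaced by B₃⁻¹ε₀, see Theorem 1 [15]»); here the `O(1)` is the kernel
constant `2` (= `Cπ` of `B12Eq311Models.norm_slProj_le`, times `‖Im X‖ ≤ ‖X‖`).  NOTHING of Bałaban's is asserted ([B11] Thm 1 stays GAPS G₈a-1∕-2∕-3;
`UkInSpaceB11`, `UkCurrentSmall` stay `Prop`s — this file proves the IMPLICATION between them, not either of them); no definition of record touched;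
counts unmoved (typed 28∕28 · discharged 1∕28); one finite `T⁴` programme at fixed `ε`; nothing here concerns the continuum, `ℝ⁴`, OS axioms, a mass
gap or the Clay problem.  Seat `pub-ymgap-dag-n01-b` (g2), 2026-08-25∕26.

THE PRINT.  [I] (1.2) p. 260 *«|J| < ε₀ on T, J = D*_U η^{−2} π Im ∂U»* and l. 3–5 below it *«is implied by the condition on V, with 2ε₀ replaced
by B₃⁻¹ε₀, see Theorem 1 [15]»* (page image read by this seat, see `Node00.BackgroundCurrentShape`); (1.8) p. 261 *«J_j = D^{ξ*}_{U_j} ξ⁻² π Im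
∂U_j»*; [B11] (2) p. 278 *«|(D*_U ∂U)(b)| < ε₀L^{−2j}(L^jη)^{−1}»*, (28) p. 282 *«J = D*η⁻² Im ∂U₀ = Im η⁻²D*∂U₀»* (= `B11Eq27Current.J_eq_imPart_div`, the
`π = id` case of §2 below); [Balaban1985RegularSpaces] (1.2) p. 76 (the covariant divergence, `B10Eq68TorusRegularity.covDivT`).

WHAT IS PROVED (kernel).  §1 (torus dictionary, any Banach `ℂ`-algebra `𝔸`, any `V : GaugeField P s 𝔸ˣ`): `plaqFT_eq_plaqField` (the two plaquette
fields agree), `covDerivT_eq_smul_covDstar` (`B10`'s `D^{η*}_ν = η⁻¹·` `B9`'s `D*_ν` on `torusT`), **`covDivT_eq_divPη`** (`B10Eq68TorusRegularity.covDivT η V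
= B9Eq39Adjoint.divPη (torusT P s) (dirForm V) η (plaqField …)` bondwise).  §2 (any `π : 𝔸 →ₗ[ℂ] 𝔸` commuting with `Ad`): **`current_eq_proj_J`** (`B12Eq18Current.current π ξ 𝐔 b = π (B9Eq39Adjoint.J (torusT P i)
(dirForm 𝐔) ξ b)` — (1.8) is `π` of (3.11)∕(28); via `B12Eq115BackgroundPair.divPη_linearMap`).  §3 (the
record, `SU(N)`, operator norm): **`currentOfRecord_eq`** (`J_U(b) = (η_k⁻¹)² • π (Im ((D^{η*}_U ∂U)(b)))` with `B10`'s `covDivT`), `norm_currentOfRecord_le`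
(`‖J_U(b)‖ ≤ 2 η_k⁻² ‖(D^{η*}_U ∂U)(b)‖`), **`currentSmall_of_regDivAt`** ([B11] (2)'s scale-`k` divergence clause at `Ω_k = T` ⇒ (1.2)'s current clause
with `2ε₀`), `inUkClass_of_inUkClassB11` (`𝔘_k({T}, ε₀) ⊆ U_k(2ε₀)`, `ε₀ ≥ 0`), **`ukCurrentSmall_of_ukInSpaceB11`** (G₈a-3: (8)-form ⇒ (1.2)-form, constant 2).
PRIOR ART (cited, not restated).  `B12Eq115BackgroundPair` §8–§9 (`current_eq_smul_map`, `norm_current_le_of_unitary`, `eq12_of_membership`,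
`eq12_of_thm1`, `mem_regularSpace_of_thm1`) already proves print's «⇐» claim of (1.2) in `B9Eq39Adjoint`'s letters (`divPη … plaqU`) over a
`Setup.Background`; THIS file's added value is only the bridge to `B10Eq68TorusRegularity`'s letters (`covDivT`, `RegDivAt`, `InSpace` = [B11] (2) as
typed) and the record-level corollaries over ₈a's `Uk`∕`bgReg` shapes of `Node00.BackgroundCurrentShape`; `pow_mul_eta`, `divPη_linearMap` are used by name.
HONEST SCOPE.  The converse inclusion `U_k(ε₀) ⊆ 𝔘_k({T}, Cε₀)` is NOT proved (and not printed: `π Im` forgets the trace and the real part of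
`D^{η*}∂U`); the constant `2` is this lineage's `Cπ`, print's is unnamed («O(1)», `B₃`).  No `sorry`; theorems only (0 def); no instance ∕ notation.
-/

noncomputable section

namespace Literature.MathematicalPhysics.QuantumFieldTheory.Balaban1983to89.Node00

open T4Continuum (T4Family)
open B9Eq39Adjoint (R covDstar divP divPη plaqU J)
open B9TorusCalculus (torusT torusT_apply torusT_symm_apply)
open B12Eq18Current (dirForm dirForm_apply imPlaq current current_apply)
open B12Lemma4Models (slProj slProj_conj)
open B10Eq27TorusAxialLog (toUField unitsField)
open B10Eq68TorusRegularity (plaqFT covDerivT covDivT RegDivAt)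
open B11Eq27Current (imPart plaqField)

/-! ## §1. Torus dictionary: `B10Eq68TorusRegularity`'s divergence IS `B9Eq39Adjoint`'s on the torus datum -/

section TorusDictionary

variable {P : Params} {s : ℕ} {𝔸 : Type*} [NormedRing 𝔸] [NormedAlgebra ℂ 𝔸]

omit [NormedAlgebra ℂ 𝔸] in
/-- The two plaquette fields agree: `B10`'s transport along the plaquette word from `x` IS `B9`'s `U(∂p_{μν}(x))` on the torus datum
(`B10Eq27TorusAxialLog.holT_plaqWord`; `B11Eq27Current.plaqField`). [cite: Balaban1985Averaging, (9) p.19 (dictionary)] -/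
theorem plaqFT_eq_plaqField (V : GaugeField P s 𝔸ˣ) (μ ν : Fin P.d) :
    plaqFT V μ ν = plaqField (torusT P s) (dirForm V) μ ν := by
  funext x
  rw [plaqFT, B10Eq27TorusAxialLog.holT_plaqWord]
  rfl

/-- `B10`'s backward covariant derivative `(D^{η*}_{V,ν}F)(x)` IS `η⁻¹·` `B9`'s `(D*_ν F)(x)` on the torus datum (`(T ν)⁻¹ x = x − e_ν`,
`R(g)X = gXg⁻¹`). [cite: Balaban1985RegularSpaces, (1.1) p.76 (dictionary)] -/
theorem covDerivT_eq_smul_covDstar (η : ℝ) (V : GaugeField P s 𝔸ˣ) (ν : Fin P.d) (F : Site P s → 𝔸) (x : Site P s) :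
    covDerivT η V ν F x = ((η : ℂ)⁻¹) • covDstar (torusT P s) (dirForm V) ν F x := by
  rw [covDerivT, covDstar, torusT_symm_apply, dirForm_apply, B9Eq39Adjoint.R_def, B7Eq78Linearization.conjR,
    ← Complex.coe_smul, Complex.ofReal_inv]

/-- **`B10Eq68TorusRegularity.covDivT` IS `B9Eq39Adjoint.divPη` of the plaquette field on the torus datum** — [Balaban1985RegularSpaces] (1.2) =
[15] (3.9) applied to `F = ∂U`, bond by bond. [cite: Balaban1985RegularSpaces, (1.2) p.76 (dictionary)] -/
theorem covDivT_eq_divPη (η : ℝ) (V : GaugeField P s 𝔸ˣ) (μ : Fin P.d) (x : Site P s) :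
    covDivT η V μ x = divPη (torusT P s) (dirForm V) η (plaqField (torusT P s) (dirForm V)) μ x := by
  simp only [covDivT, covDerivT_eq_smul_covDstar, plaqFT_eq_plaqField, divPη, divP, smul_sub, Finset.smul_sum, smul_ite, smul_zero]
  rw [← Finset.sum_filter, ← Finset.sum_filter, Finset.filter_gt_eq_Iio, Finset.filter_lt_eq_Ioi]

end TorusDictionary

/-! ## §2. The (1.8) current is `π` of the (3.11)∕(28) current (via `B12Eq115BackgroundPair.divPη_linearMap`) -/

section Proj

variable {P : Params} {i : ℕ} {𝔸 : Type*} [Ring 𝔸] [Algebra ℂ 𝔸]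

/-- **(1.8) = `π` ∘ (3.11)∕(28)**: `B12Eq18Current.current π ξ 𝐔 (b) = π (B9Eq39Adjoint.J (torusT) (dirForm 𝐔) ξ b)` for `π` commuting with `Ad`
— the `π` and the scalar pass through `D^{ξ*}` by `B12Eq115BackgroundPair.divPη_linearMap` ([14] (1.11) mechanism; cf. its `current_eq_smul_map`).
[cite: Balaban1987RG1, (1.8) p.261] -/
theorem current_eq_proj_J (π : 𝔸 →ₗ[ℂ] 𝔸) (hπ : ∀ (g : 𝔸ˣ) (X : 𝔸), π (R g X) = R g (π X)) (ξ : ℝ) (U : PBond P i → 𝔸ˣ)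
    (b : PBond P i) : current π ξ U b = π (J (torusT P i) (dirForm U) ξ b.dir b.src) := by
  have himPlaq : imPlaq π ξ U = fun κ ν y => π ((((ξ : ℂ)⁻¹) ^ 2) • B9Eq37Insertion.imC (plaqU (torusT P i) (dirForm U) κ ν y)) := by
    funext κ ν y
    rw [imPlaq, map_smul]
  show divPη (torusT P i) (dirForm U) ξ (imPlaq π ξ U) b.dir b.src = _
  rw [himPlaq, B12Eq115BackgroundPair.divPη_linearMap _ _ ξ π (fun μ y X => hπ _ X), J]

end Proj

/-! ## §3. At the record: `J_U = η_k⁻² π Im(D^{η*}_U ∂U)`, the norm comparison, `𝔘_k({T}, ε₀) ⊆ U_k(2ε₀)`, G₈a-3 (8)-form ⇒ (1.2)-form -/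

section Record

open scoped Matrix.Norms.L2Operator

variable (F : T4Family) (N : ℕ)

/-- The `GL`-valued reading is unitary bond by bond: `𝐔(b)⁻¹ = 𝐔(b)*` (the hypothesis `hU` of `B11Eq27Current`). [cite: Balaban1985Variational, (28) p.282 (bookkeeping)] -/
theorem dirForm_cfgGL_inv_eq_star {P : Params} {j : ℕ} (U : GaugeField P j (SU N)) (μ : Fin P.d) (x : Site P j) :
    (((dirForm (cfgGL N U) μ x)⁻¹ : (Matrix (Fin N) (Fin N) ℂ)ˣ) : Matrix (Fin N) (Fin N) ℂ) =
      star ((dirForm (cfgGL N U) μ x : (Matrix (Fin N) (Fin N) ℂ)ˣ) : Matrix (Fin N) (Fin N) ℂ) :=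
  Units.inv_eq_of_mul_eq_one_right (Unitary.mul_star_self_of_mem (U ⟨x, μ⟩).2.1)

/-- **`J_U(b) = (η_k⁻¹)² · π (Im ((D^{η*}_U ∂U)(b)))`** — the current of record ([I] (1.2)∕(1.8)) in terms of `B10Eq68TorusRegularity`'s divergence
([B11] (2)): `current_eq_proj_J` + `B11Eq27Current.J_eq_imPart_div` ((28): `J = Im η⁻²D*∂U`) + `covDivT_eq_divPη`. [cite: Balaban1987RG1, (1.2) p.260] -/
theorem currentOfRecord_eq (K k : ℕ) (U : GaugeField (F.P K) 0 (SU N)) (b : PBond (F.P K) 0) :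
    currentOfRecord F N K k U b =
      ((((F.P K).eta k : ℂ)⁻¹) ^ 2) • slProj N (imPart (covDivT ((F.P K).eta k) (cfgGL N U) b.dir b.src)) := by
  rw [currentOfRecord, current_eq_proj_J (slProj N) (fun g X => slProj_conj g X),
    B11Eq27Current.J_eq_imPart_div _ _ (dirForm_cfgGL_inv_eq_star N U), map_smul, covDivT_eq_divPη]

/-- **`‖J_U(b)‖ ≤ 2 η_k⁻² ‖(D^{η*}_U ∂U)(b)‖`** (operator norms): `‖πX‖ ≤ 2‖X‖` (`B12Eq311Models.norm_slProj_le`) and `‖Im X‖ ≤ ‖X‖`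
(`B11Eq27Current.norm_imPart_le`). [cite: Balaban1987RG1, (1.2) p.260] -/
theorem norm_currentOfRecord_le (K k : ℕ) (U : GaugeField (F.P K) 0 (SU N)) (b : PBond (F.P K) 0) :
    ‖currentOfRecord F N K k U b‖ ≤ 2 * ((F.P K).eta k)⁻¹ ^ 2 * ‖covDivT ((F.P K).eta k) (cfgGL N U) b.dir b.src‖ := by
  rw [currentOfRecord_eq, norm_smul, norm_pow, norm_inv, Complex.norm_real, Real.norm_eq_abs, abs_of_pos (pow_pos (inv_pos.mpr (Nat.cast_pos.mpr (F.P K).L_pos)) k)]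
  have h1 := B12Eq311Models.norm_slProj_le (imPart (covDivT ((F.P K).eta k) (cfgGL N U) b.dir b.src))
  have h2 := B11Eq27Current.norm_imPart_le (covDivT ((F.P K).eta k) (cfgGL N U) b.dir b.src)
  have hη : 0 ≤ ((F.P K).eta k)⁻¹ ^ 2 := by positivity
  calc ((F.P K).eta k)⁻¹ ^ 2 * ‖slProj N (imPart (covDivT ((F.P K).eta k) (cfgGL N U) b.dir b.src))‖
      ≤ ((F.P K).eta k)⁻¹ ^ 2 * (2 * ‖covDivT ((F.P K).eta k) (cfgGL N U) b.dir b.src‖) :=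
        mul_le_mul_of_nonneg_left (h1.trans (by linarith)) hη
    _ = 2 * ((F.P K).eta k)⁻¹ ^ 2 * ‖covDivT ((F.P K).eta k) (cfgGL N U) b.dir b.src‖ := by ring

/-- **[B11] (2)'s scale-`k` divergence clause at `Ω_k = T` ⇒ [I] (1.2)'s current clause with `2ε₀`**: `‖(D^{η*}_U∂U)(b)‖ < ε₀(L^k)⁻²(L^kη_k)⁻¹ = ε₀η_k²`
for all `b` gives `‖J_U(b)‖ < 2ε₀`. [cite: Balaban1987RG1, (1.2) p.260] -/
theorem currentSmall_of_regDivAt {K k : ℕ} {ε₀ : ℝ} {U : GaugeField (F.P K) 0 (SU N)}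
    (h : RegDivAt k (Set.univ : Set (Site (F.P K) 0)) ε₀ ((F.P K).eta k) (cfgGL N U)) : CurrentSmall F N K k (2 * ε₀) U := by
  intro b
  have hη : 0 < (F.P K).eta k := pow_pos (inv_pos.mpr (Nat.cast_pos.mpr (F.P K).L_pos)) k
  have hb := h b (Or.inl (Set.mem_univ _))
  rw [B12Eq115BackgroundPair.pow_mul_eta, inv_one, mul_one, inv_pow_sq_eq_eta_sq] at hb
  have hle := norm_currentOfRecord_le F N K k U b
  have hkey : 2 * ((F.P K).eta k)⁻¹ ^ 2 * ‖covDivT ((F.P K).eta k) (cfgGL N U) b.dir b.src‖ < 2 * ε₀ := by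
    have hpos : 0 < 2 * ((F.P K).eta k)⁻¹ ^ 2 := by positivity
    calc 2 * ((F.P K).eta k)⁻¹ ^ 2 * ‖covDivT ((F.P K).eta k) (cfgGL N U) b.dir b.src‖
        < 2 * ((F.P K).eta k)⁻¹ ^ 2 * (ε₀ * (F.P K).eta k ^ 2) := mul_lt_mul_of_pos_left hb hpos
      _ = 2 * ε₀ := by field_simp
  exact hle.trans_lt hkey

variable [NeZero N]

/-- **`𝔘_k({T}, ε₀) ⊆ U_k(2ε₀)`**: [B11] (2)'s full space at `Ω_j = T` lies in print's full (1.2)-space with the constant doubled (`ε₀ ≥ 0`).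
[cite: Balaban1987RG1, (1.2) p.260] -/
theorem inUkClass_of_inUkClassB11 {K k : ℕ} {ε₀ : ℝ} (hε : 0 ≤ ε₀) {U : GaugeField (F.P K) 0 (SU N)}
    (h : InUkClassB11 F N K k ε₀ U) : InUkClass F N K k (2 * ε₀) U := by
  refine ⟨?_, currentSmall_of_regDivAt F N ((inUkClassB11_iff hε U).1 h).2⟩
  rw [mem_bgReg_iff]
  intro p
  have hp := (mem_bgReg_iff F N K k ε₀ U).1 h.mem_bgReg p
  have : ε₀ * (F.P K).eta k ^ 2 ≤ 2 * ε₀ * (F.P K).eta k ^ 2 := by nlinarith [sq_nonneg ((F.P K).eta k)]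
  exact hp.trans_le this

/-- **GAPS G₈a-3: ITS [B11] Thm 1 (8)-FORM IMPLIES ITS [I] (1.2)-FORM** (constant `2`): if the minimiser of record lies in `𝔘_k({T}, ε₀)` whenever
the problem is solvable, then it satisfies `|J| < 2ε₀` — print's *«implied by … see Theorem 1 [15]»* ([I] p. 260) at the level of the typed
shapes; neither side is asserted. [cite: Balaban1987RG1, (1.2) p.260] -/
theorem ukCurrentSmall_of_ukInSpaceB11 {K k : ℕ} {ε ε₀ : ℝ} (h : UkInSpaceB11 F N K k ε ε₀) : UkCurrentSmall F N K k ε (2 * ε₀) :=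
  fun V hV => currentSmall_of_regDivAt F N ((h V hV).regDivAt le_rfl)

end Record

end Literature.MathematicalPhysics.QuantumFieldTheory.Balaban1983to89.Node00

end
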